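import Summits.AtomisticToContinuum.HydrodynamicLimit.Theorems.ImplosionDichotomyDiluteSelfConsistencyPreSingular
import Summits.AtomisticToContinuum.HydrodynamicLimit.Theorems.ImplosionDichotomyDiluteSelfConsistencyNoIdealDevelopmentTrivial
import Summits.AtomisticToContinuum.HydrodynamicLimit.Theorems.DiluteSelfConsistency.Negative.Tightness

/-!
# The TIME LOCALISATION of the crux `DiluteSelfConsistency` (stmt-AtomisticToContinuum-3091): the crux is EQUIVALENT
# to σ-uniform diluteness at and beyond the first singular time of the ideal development

Line `birth` rev c3 (lead prover-line-stmt-AtomisticToContinuum-3091-c3-0). With pieces B.0 (`stub_noIdealDevelopmentTrivial`,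
p148786) and B.1 (`diluteSelfConsistency_preSingular`, p150709 — a theorem through `eosContinuity_holds` and the discharged
named fact `hsEuler_continuousDependence_holds`) of the crux-strategist's time split landed, the crux reduces EXACTLY to
its post-window piece B.2 (`diluteSelfConsistency_iff_postWindow`): `DiluteSelfConsistency` holds iff for every level
`η > 0`, all continuous positive profiles and every classical ideal-gas development of the reference data on a nonempty
`[0, T₁)` there are a window start `T₂ ∈ (0, T₁)` and a threshold `σ₀ > 0` below which every classical hard-sphere Euler
σ-solution tied to the local Gibbs data at `t = 0` has packing `ρσ³ < η` on `(T₂, T)`. This is the decision-bearing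
statement of the line (registered stub `stub_postWindowDilute`); at a tuned implosion profile it is `¬DenseExcursion`
in substance (`not_denseExcursion_iff_diluteSelfConsistency`) and is decided by stmt-AtomisticToContinuum-12586.
-/

noncomputable section

namespace Summit.AtomisticToContinuum.HydrodynamicLimit.Theorems

open MeasureTheory Filter Set Topology
open Literature.MathematicalPhysics.KineticTheory Literature.Analysis.FluidPDE Literature.Analysis.FunctionSpaces
open Summit.AtomisticToContinuum.HydrodynamicLimit.Theses.ImplosionDichotomy

/-- **Time localisation of the crux.** `DiluteSelfConsistency` ↔ post-window diluteness (piece B.2): σ-uniform density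
control at and beyond the first singular time of every ideal classical development of the reference data. (`→`: restrict
the crux's conclusion to the window `(T₁/2, T)`. `←`: pick an ideal development if there is one — B.2's window start
`T₂` and threshold, B.1 `diluteSelfConsistency_preSingular` on `[0, T₂]`, the minimum of the two thresholds; profiles
with no ideal development are trivial, B.0 `stub_noIdealDevelopmentTrivial`.) [cite: Kato1975, Thm III] -/
theorem diluteSelfConsistency_iff_postWindow :
    DiluteSelfConsistency ↔
      ∀ η : ℝ, 0 < η → ∀ (a₀ θ₀ : T3 → ℝ) (u₀ : T3 → V3), Continuous a₀ → Continuous θ₀ → Continuous u₀ →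
        (∀ x, 0 < a₀ x) → (∀ x, 0 < θ₀ x) →
        ∀ (T₁ : ℝ) (ρ₁ θ₁ : ℝ → T3 → ℝ) (u₁ : ℝ → T3 → V3), 0 < T₁ → IsHardSphereEulerSolution 0 T₁ ρ₁ u₁ θ₁ →
          (∀ x, ρ₁ 0 x = a₀ x / ∫ y, a₀ y) → u₁ 0 = u₀ → θ₁ 0 = θ₀ →
          ∃ T₂ : ℝ, 0 < T₂ ∧ T₂ < T₁ ∧ ∃ σ₀ : ℝ, 0 < σ₀ ∧ ∀ σ : ℝ, 0 < σ → σ < σ₀ →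
            ∀ (T : ℝ) (ρ θ : ℝ → T3 → ℝ) (u : ℝ → T3 → V3), IsHardSphereEulerSolution σ T ρ u θ →
              ∀ Φ : (N : ℕ) → HardSphereFlow (Torus.geometry (Fin 3)) (hsDiameter σ N) (N + 1),
                TendstoHydroFieldsAt (fun N => localGibbsLaw σ a₀ u₀ θ₀ N (Φ N)) Φ ρ u θ 0 →
                  ∀ t ∈ Ico 0 T, T₂ < t → ∀ x, ρ t x * σ ^ 3 < η := by
  constructor
  · -- adapted from `StrategistR1.preSingular_and_postWindow_of_dsc` (Cruxes/DiluteSelfConsistency/StrategistSketchR1.lean)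
    intro h η hη a₀ θ₀ u₀ ha hθ hu ha0 hθ0 T₁ ρ₁ θ₁ u₁ hT₁ _ _ _ _
    obtain ⟨σ₀, hσ₀, H⟩ := h η hη a₀ θ₀ u₀ ha hθ hu ha0 hθ0
    exact ⟨T₁ / 2, by linarith, by linarith, σ₀, hσ₀,
      fun σ hσ hσlt T ρ θ u hE Φ htie t ht _ x => H σ hσ hσlt T ρ θ u hE Φ htie t ht x⟩
  · -- adapted from `StrategistR1.dsc_of_timeSplit`
    intro h2 η hη a₀ θ₀ u₀ ha hθ hu ha0 hθ0
    by_cases hdev : ∃ (T₁ : ℝ) (ρ₁ θ₁ : ℝ → T3 → ℝ) (u₁ : ℝ → T3 → V3), 0 < T₁ ∧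
        IsHardSphereEulerSolution 0 T₁ ρ₁ u₁ θ₁ ∧ (∀ x, ρ₁ 0 x = a₀ x / ∫ y, a₀ y) ∧ u₁ 0 = u₀ ∧ θ₁ 0 = θ₀
    · obtain ⟨T₁, ρ₁, θ₁, u₁, hT₁, hsol, hd, hu0, hθ0'⟩ := hdev
      obtain ⟨T₂, hT₂, hT₂1, σ₂, hσ₂, H2⟩ :=
        h2 η hη a₀ θ₀ u₀ ha hθ hu ha0 hθ0 T₁ ρ₁ θ₁ u₁ hT₁ hsol hd hu0 hθ0'
      obtain ⟨σ₁, hσ₁, H1⟩ :=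
        diluteSelfConsistency_preSingular η hη a₀ θ₀ u₀ ha hθ hu ha0 hθ0 T₁ ρ₁ θ₁ u₁ hsol hd hu0 hθ0' T₂ hT₂ hT₂1
      refine ⟨min σ₁ σ₂, lt_min hσ₁ hσ₂, ?_⟩
      intro σ hσ hσlt T ρ θ u hE Φ htie t ht x
      by_cases htT : t ≤ T₂
      · exact H1 σ hσ (lt_of_lt_of_le hσlt (min_le_left _ _)) T ρ θ u hE Φ htie t ht htT x
      · exact H2 σ hσ (lt_of_lt_of_le hσlt (min_le_right _ _)) T ρ θ u hE Φ htie t ht (lt_of_not_ge htT) x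
    · obtain ⟨σ₀, hσ₀, H⟩ := stub_noIdealDevelopmentTrivial η hη a₀ θ₀ u₀ ha hθ hu ha0 hθ0 hdev
      exact ⟨σ₀, hσ₀, H⟩

end Summit.AtomisticToContinuum.HydrodynamicLimit.Theorems

end
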